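import Literature.Claims.NS.Atarka2026
import Literature.Analysis.ODE.SuperlinearDampedDecay
import HarnessLib

/-!
# Solo salvage for claim C128 `Atarka2026` (cell `ns-claims`, D-0090): Théorème 8.1 follows from Théorème 7.1
# — the small-data step (25) is a correct ODE comparison, kernel-discharged

Claim skeleton: `Literature/Claims/NS/Atarka2026.lean` (typist-12 g2, p488843): A. Atarka, HAL hal-05563207
v1 (2026), Thm 11.1 (global regularity on a bounded no-slip domain via the functional
`E = ½‖T(u)u‖² + ν²/2‖Δu‖²`). This file (seat `ns-claims-salvage-p2`, salvage lane of C128) proves the one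
implication of the chain that is honest real analysis: IF the differential inequality (19)
`dE/dt ≤ C E^{3/2} − αE` holds along regular solutions (`Thm71`, the expected locator), THEN the small-data
decay (25) `E(t) ≤ E(T₀)e^{−α(t−T₀)/2}` for `E(T₀) ≤ δ₀ := (α/(4C))²` holds (`Thm81`) — the printed «ODE
comparison for `y' ≤ Cy^{3/2} − αy` with `Cδ₀^{1/2} ≤ α/2`» [p. 6, l. 40–49], through the tree lemma
`Literature.Analysis.ODE.le_mul_exp_of_deriv_le_rpow_sub` (fencing against `(y₀+ε)e^{−αt/2}`).

* `smallDecay_of_diffIneq` — `DiffIneq Ω ν C α` (with `C, α > 0`) ⇒ `SmallDecay Ω ν α (α/(4C))²`;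
* `thm81_of_thm71 : Thm71 → Thm81`.

Solo lane (`Theorems/SoloSalvage<Slug>.lean`, no item).

WHAT THIS IS NOT: not a claim about NS regularity or blow-up; not a claim about any author beyond the
typed locator.
-/

noncomputable section

open Set Filter Topology

-- The mandated landing namespace repeats the summit name by design (D-0017).
set_option linter.dupNamespace false

namespace Summit.NavierStokesRegularity.NavierStokesRegularity.Theorems

namespace Atarka2026

open Literature.Claims.NS.Atarka2026

/-- The printed time sets `[0,∞)` and `[0,T)` are sets of unique differentiability containing, with two of
their points `T₀ ≤ t`, the whole segment `[T₀, t]`. [folklore] -/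
private theorem timeSet_props {S : Set ℝ} (hS : TimeSet S) :
    UniqueDiffOn ℝ S ∧ ∀ {a b : ℝ}, a ∈ S → b ∈ S → Icc a b ⊆ S := by
  rcases hS with rfl | ⟨T, hT, rfl⟩
  · exact ⟨uniqueDiffOn_Ici 0, fun ha _ x hx => le_trans ha hx.1⟩
  · exact ⟨uniqueDiffOn_Ico 0 T, fun ha hb x hx => ⟨le_trans ha.1 hx.1, lt_of_le_of_lt hx.2 hb.2⟩⟩

/-- **(19) ⇒ (25)**: if `E` obeys `dE/dt ≤ C E^{3/2} − αE` along every regular solution on `Ω` (`C, α > 0`),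
then every regular solution with `E(T₀) ≤ δ₀ := (α/(4C))²` satisfies `E(t) ≤ E(T₀) e^{−α(t−T₀)/2}` for
`t ≥ T₀` in the time set (Thm 8.1's printed ODE comparison). [cite: Atarka2026, Thm 8.1 (25) p.6 l.35–49] -/
theorem smallDecay_of_diffIneq {Ω : TopologicalSpace.Opens E3} {ν C α : ℝ} (hC : 0 < C) (hα : 0 < α)
    (h : DiffIneq Ω ν C α) : SmallDecay Ω ν α ((α / (4 * C)) ^ 2) := by
  intro S u₀ u p hS hsol T₀ hT₀ hsmall t ht hle
  obtain ⟨hU, hseg⟩ := timeSet_props hS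
  have hsub : Icc T₀ t ⊆ S := hseg hT₀ ht
  -- the scalar function `y(s) = E(u(T₀ + s))` on `[0, t - T₀]`
  set Ef : ℝ → ℝ := fun σ => Efun Ω ν (u σ) with hEf
  set y : ℝ → ℝ := fun s => Ef (T₀ + s) with hy
  set y' : ℝ → ℝ := fun s => derivWithin Ef S (T₀ + s) with hy'
  set b : ℝ := t - T₀ with hb
  have hb0 : 0 ≤ b := by rw [hb]; linarith
  have hmemS : ∀ s ∈ Icc 0 b, T₀ + s ∈ S := fun s hs =>
    hsub ⟨by linarith [hs.1], by rw [hb] at hs; linarith [hs.2]⟩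
  -- derivative data from (19)
  have hder : ∀ s ∈ Icc 0 b, HasDerivWithinAt Ef (y' s) S (T₀ + s) ∧
      y' s ≤ C * Ef (T₀ + s) ^ ((3 : ℝ) / 2) - α * Ef (T₀ + s) := by
    intro s hs
    obtain ⟨D, hD, hDle⟩ := h S u₀ u p hS hsol (T₀ + s) (hmemS s hs)
    have heq : y' s = D := by
      simp only [hy']
      exact hD.derivWithin (hU _ (hmemS s hs))
    rw [heq]
    exact ⟨hD, hDle⟩
  have hcont : ContinuousOn y (Icc 0 b) := by
    intro s hs
    have hc : ContinuousWithinAt Ef S (T₀ + s) := (hder s hs).1.continuousWithinAt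
    have hc' : ContinuousWithinAt Ef (Icc T₀ t) (T₀ + s) := hc.mono hsub
    have hmap : MapsTo (fun σ : ℝ => T₀ + σ) (Icc 0 b) (Icc T₀ t) := fun σ hσ =>
      ⟨by linarith [hσ.1], by rw [hb] at hσ; linarith [hσ.2]⟩
    exact hc'.comp (continuous_const.add continuous_id).continuousWithinAt hmap
  have hderiv : ∀ s ∈ Ico 0 b, HasDerivWithinAt y (y' s) (Ici s) s := by
    intro s hs
    have h1 : HasDerivWithinAt Ef (y' s) (Icc T₀ t) (T₀ + s) :=
      ((hder s (Ico_subset_Icc_self hs)).1).mono hsub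
    have h2 : HasDerivWithinAt Ef (y' s) (Ici (T₀ + s)) (T₀ + s) :=
      h1.mono_of_mem_nhdsWithin (Icc_mem_nhdsGE_of_mem ⟨by linarith [hs.1], by rw [hb] at hs; linarith [hs.2]⟩)
    have h3 : HasDerivWithinAt (fun σ : ℝ => T₀ + σ) 1 (Ici s) s :=
      ((hasDerivWithinAt_id s (Ici s)).const_add T₀)
    have h4 := h2.comp s h3 (fun σ hσ => by simpa using hσ)
    simpa [hy, Function.comp_def] using h4
  have hnn : ∀ s ∈ Icc 0 b, 0 ≤ y s := fun s _ => efun_nonneg (Ω := Ω) ν _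
  have hineq : ∀ s ∈ Ico 0 b, y' s ≤ C * y s ^ ((3 : ℝ) / 2) - α * y s := fun s hs =>
    (hder s (Ico_subset_Icc_self hs)).2
  -- smallness at `s = 0`: `C √(E(T₀)) ≤ C · α/(4C) = α/4 < α/2`
  have hy0 : y 0 = Efun Ω ν (u T₀) := by simp [hy, hEf]
  have hsm : C * Real.sqrt (y 0) < α / 2 := by
    rw [hy0]
    have h1 : Real.sqrt (Efun Ω ν (u T₀)) ≤ α / (4 * C) := by
      rw [← Real.sqrt_sq (by positivity : (0 : ℝ) ≤ α / (4 * C))]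
      exact Real.sqrt_le_sqrt hsmall
    calc C * Real.sqrt (Efun Ω ν (u T₀)) ≤ C * (α / (4 * C)) := mul_le_mul_of_nonneg_left h1 hC.le
      _ = α / 4 := by field_simp
      _ < α / 2 := by linarith
  have hres := Literature.Analysis.ODE.le_mul_exp_of_deriv_le_rpow_sub hα hC.le hcont hderiv hnn hineq
    hsm b ⟨hb0, le_rfl⟩
  have hyb : y b = Efun Ω ν (u t) := by simp [hy, hEf, hb]
  rw [hyb, hy0] at hres
  have hexp : -(α / 2) * b = -(α * (t - T₀) / 2) := by rw [hb]; ring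
  rw [hexp] at hres
  exact hres

/-- **Théorème 8.1 follows from Théorème 7.1** (kernel): the small-data decay step (25) of the chain is a
correct consequence of the differential inequality (19), with `δ₀ = (α/(4C))²`.
[cite: Atarka2026, Thm 8.1 (25) p.6 l.35–49 from Thm 7.1 (19) p.5 l.81–84] -/
theorem thm81_of_thm71 (h71 : Literature.Claims.NS.Atarka2026.Thm71) :
    Literature.Claims.NS.Atarka2026.Thm81 := by
  intro Ω ν hΩ hν
  obtain ⟨C, α, hC, hα, hDI⟩ := h71 Ω ν hΩ hν
  exact ⟨α, (α / (4 * C)) ^ 2, hα, by positivity, smallDecay_of_diffIneq hC hα hDI⟩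

end Atarka2026

end Summit.NavierStokesRegularity.NavierStokesRegularity.Theorems
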